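import Mathlib
import Summits.NavierStokesRegularity.NavierStokesRegularity.Theorems.EulerZoomLiouvillePowerGaugeEulerLiouvilleSelfSimilarPastProfileEquations
import Summits.NavierStokesRegularity.NavierStokesRegularity.Theorems.EulerZoomLiouvillePowerGaugeEulerLiouvilleEnergySaturationLoc
import Summits.NavierStokesRegularity.NavierStokesRegularity.Theorems.EulerZoomLiouvillePowerGaugeEulerLiouvilleAllRhoStrata
import HarnessLib

/-!
# PAST-EXACT and SHIFTED self-similar members of crux E: NO SUB-EXTREMAL COLLAPSE
# (crux `EulerZoomLiouville.PowerGaugeEulerLiouville` = stmt-NavierStokesRegularity-19832, line `birth`, rung C1 — member level)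

Route `EulerZoomLiouville` (NavierStokesRegularity); width seat ns-ezl-w1 (RESIDUE-MEMO-19832-g9 §2: «the shifted sub-extremal
family did NOT move with the classical one … expected repair: restate the Bronzi–Shvydkoy energy-law chain at large scales»).
COMPOSITION of the past/shifted profile dictionary (`Past.profileData_of_past`: bricks 1–4) with the large-scale re-plumb of the
sub-extremal chain (`EnergySaturation.ae_eq_zero_of_subExtremal_loc`) and the crux's energy-vanishing stratum
(`ae_eq_zero_of_gauge_of_energyVanishing_allRho`, the filled `stub_quiescentPast`):

* `Past.growth_ge_one_of_growth_ge` — thresholds `L ≥ L₀` to `L ≥ 1` (`θ ≥ 0`);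
* `Past.ae_eq_zero_of_profile_ae_eq_zero` — a past-exact member whose velocity profile vanishes A.E. vanishes on the whole slab
  (`u(τ) = 0` a.e. for every `τ < T₁` ⇒ energy-quiescent past ⇒ trivial; a.e. twin of `Past.ae_eq_zero_of_profile_eq_zero`);
* `Past.selfSimilar_ae_eq_zero_of_subExtremal_past` — **NO SUB-EXTREMAL SELF-SIMILAR EULER COLLAPSE ABOUT ANY POINT, EVEN ONLY IN
  THE PAST**: crux hypotheses verbatim (`0 < ρ ≤ ½`), `u`, `p` exactly self-similar about `(T, x₀)` with profile `(V, P)` for `τ < T₁`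
  (`T₁ ≤ 0`, `T₁ ≤ T`), and `liminf_{L→∞} L^{2ρ−1}∫_{B_L}|V|² = 0` ⇒ `u = 0` a.e. on `(−∞,0) × ℝ³`.  Equivalently a nontrivial such
  member SATURATES the `A`-gauge: `∫_{B_L}|V|² ≥ c₁ L^{1−2ρ}` for all large `L` (Bronzi–Shvydkoy 2015 Thm 1.1 in Seregin's weak
  class, now for members self-similar about `(T, x₀) ≠ (0,0)` / on a past sub-slab);
* `Past.selfSimilar_ae_eq_zero_of_finiteEnergy_profile_past` — corollary (`0 < ρ < ½`): finite-energy profile ⇒ trivial.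

The case `T = T₁ = 0`, `x₀ = 0` is the tree's `EnergySaturation.selfSimilar_ae_eq_zero_of_subExtremal` (`stub_selfSimilarSubExtremal`).
WHAT THIS IS NOT: not NS, not E, not a stub of the skeleton of record — a member-level stratum `--supports` stmt-19832 (it removes the
SHIFTED / PAST-EXACT SUB-EXTREMAL family from the complement defining `stub_nonSelfSimilarRest`; wiring is the LEAD's).
[folklore; cf. BronziShvydkoy2015 Thm 1.1]
-/

noncomputable section

-- flat `Theorems/<Route><Decl>…` files of one crux share the namespace of the crux (tree convention: `Summit.<S>.<S>.…`)
set_option linter.dupNamespace false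

open MeasureTheory Set Filter Topology Metric Function TopologicalSpace
open scoped ENNReal NNReal InnerProductSpace RealInnerProductSpace Laplacian

namespace Summit.NavierStokesRegularity.NavierStokesRegularity.Theorems.PowerGaugeEulerLiouville

open Literature.Analysis Literature.Analysis.FunctionSpaces Literature.Analysis.FluidPDE

namespace Past

/-! ### Thresholds `L ≥ L₀` to `L ≥ 1` -/

/-- A growth bound `∫_{B_L} f ≤ C L^θ` for `L ≥ L₀` (`L₀ ≥ 1`, `θ ≥ 0`) gives `∫_{B_L} f ≤ (C L₀^θ) L^θ` for all `L ≥ 1`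
(`B_L ⊆ B_{L₀}` below the threshold). [folklore] -/
theorem growth_ge_one_of_growth_ge {f : EuclideanSpace ℝ (Fin 3) → ℝ≥0∞} {C : ℝ≥0∞} {L₀ θ : ℝ}
    (hL₀ : 1 ≤ L₀) (hθ : 0 ≤ θ)
    (h : ∀ L : ℝ, L₀ ≤ L → ∫⁻ y in ball (0 : EuclideanSpace ℝ (Fin 3)) L, f y ≤ C * ENNReal.ofReal (L ^ θ)) :
    ∀ L : ℝ, 1 ≤ L → ∫⁻ y in ball (0 : EuclideanSpace ℝ (Fin 3)) L, f y ≤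
      C * ENNReal.ofReal (L₀ ^ θ) * ENNReal.ofReal (L ^ θ) := by
  intro L hL
  have h1 : (1 : ℝ≥0∞) ≤ ENNReal.ofReal (L₀ ^ θ) := by
    rw [← ENNReal.ofReal_one]; exact ENNReal.ofReal_le_ofReal (Real.one_le_rpow hL₀ hθ)
  have h1' : (1 : ℝ≥0∞) ≤ ENNReal.ofReal (L ^ θ) := by
    rw [← ENNReal.ofReal_one]; exact ENNReal.ofReal_le_ofReal (Real.one_le_rpow hL hθ)
  rcases le_or_gt L₀ L with hLL | hLL
  · calc ∫⁻ y in ball (0 : EuclideanSpace ℝ (Fin 3)) L, f y ≤ C * ENNReal.ofReal (L ^ θ) := h L hLL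
      _ = C * 1 * ENNReal.ofReal (L ^ θ) := by rw [mul_one]
      _ ≤ C * ENNReal.ofReal (L₀ ^ θ) * ENNReal.ofReal (L ^ θ) := by gcongr
  · calc ∫⁻ y in ball (0 : EuclideanSpace ℝ (Fin 3)) L, f y
        ≤ ∫⁻ y in ball (0 : EuclideanSpace ℝ (Fin 3)) L₀, f y := lintegral_mono_set (ball_subset_ball hLL.le)
      _ ≤ C * ENNReal.ofReal (L₀ ^ θ) := h L₀ le_rfl
      _ = C * ENNReal.ofReal (L₀ ^ θ) * 1 := (mul_one _).symm
      _ ≤ C * ENNReal.ofReal (L₀ ^ θ) * ENNReal.ofReal (L ^ θ) := by gcongr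

/-! ### From an a.e.-vanishing profile to a vanishing member -/

/-- **A past-exact member whose velocity profile vanishes a.e. is trivial** (crux hypotheses verbatim, any `ρ ≥ 0`): for every
`τ < T₁` the slice `u(τ) = (T−τ)^{γ−1} V((T−τ)^{−γ}(· − x₀))` vanishes a.e. (translated dilations are quasi-measure-preserving),
so the past is energy-quiescent and the crux's filled stratum `ae_eq_zero_of_gauge_of_energyVanishing_allRho` applies.  A.e. twin
of `Past.ae_eq_zero_of_profile_eq_zero`. [folklore] -/
theorem ae_eq_zero_of_profile_ae_eq_zero {ρ γ T T₁ : ℝ} {x₀ : EuclideanSpace ℝ (Fin 3)}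
    {u : ℝ → EuclideanSpace ℝ (Fin 3) → EuclideanSpace ℝ (Fin 3)} {p : ℝ → EuclideanSpace ℝ (Fin 3) → ℝ}
    {H : ℝ → EuclideanSpace ℝ (Fin 3) → EuclideanSpace ℝ (Fin 3) →L[ℝ] EuclideanSpace ℝ (Fin 3)} {c : ℝ≥0}
    {V : EuclideanSpace ℝ (Fin 3) → EuclideanSpace ℝ (Fin 3)}
    (hρ : 0 ≤ ρ) (hTT₁ : T₁ ≤ T)
    (hsw : IsSuitableWeakSolutionOn (slab (EuclideanSpace ℝ (Fin 3)) (Iio 0) isOpen_Iio) 0 0 u p)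
    (hH : HasWeakSpatialGradientOn (slab (EuclideanSpace ℝ (Fin 3)) (Iio 0) isOpen_Iio) u H)
    (hgauge : ∀ a : ℝ, 0 < a →
      ENNReal.ofReal (a ^ (2 * ρ)) * cknA a (0 : ℝ × EuclideanSpace ℝ (Fin 3)) u +
          ENNReal.ofReal (a ^ ρ) * cknE a (0 : ℝ × EuclideanSpace ℝ (Fin 3)) H +
        ENNReal.ofReal (a ^ (2 * ρ)) * cknD a (0 : ℝ × EuclideanSpace ℝ (Fin 3)) p ≤ (c : ℝ≥0∞))
    (hu : ∀ τ : ℝ, τ < T₁ → u τ = fun x => selfSimilarCollapse γ T V τ (x - x₀))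
    (hV0 : V =ᵐ[volume] 0) :
    uncurry u =ᵐ[volume.restrict (Iio (0 : ℝ) ×ˢ (univ : Set (EuclideanSpace ℝ (Fin 3))))] 0 := by
  refine ae_eq_zero_of_gauge_of_energyVanishing_allRho hρ hsw hH hgauge fun ε hε N => ?_
  -- the energy vanishes identically for `s < min (−N) T₁`
  have hsub : Iio (min (-N) T₁) ⊆ {s : ℝ | s < -N ∧ ∫⁻ x, ‖u s x‖ₑ ^ 2 ≤ ENNReal.ofReal ε} := by
    intro s hs
    rw [mem_Iio, lt_min_iff] at hs
    refine ⟨hs.1, ?_⟩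
    have hsT : 0 < T - s := by linarith [hs.2]
    have hd : (T - s) ^ (-γ) ≠ 0 := (Real.rpow_pos_of_pos hsT _).ne'
    have hae : (fun x => ‖u s x‖ₑ ^ 2) =ᵐ[volume] fun _ => 0 := by
      have h1 := (quasiMeasurePreserving_smul_sub hd x₀).ae_eq_comp hV0
      filter_upwards [h1] with x hx
      simp only [comp_apply, Pi.zero_apply] at hx
      rw [hu s hs.2]
      simp [selfSimilarCollapse_apply, hx]
    rw [lintegral_congr_ae hae, lintegral_zero]
    exact zero_le
  have hinf : volume (Iio (min (-N) T₁)) = (⊤ : ℝ≥0∞) := Real.volume_Iio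
  intro h0
  have := measure_mono_null hsub h0
  rw [hinf] at this
  exact ENNReal.top_ne_zero this

/-! ### The large-scale profile data of a past-exact member in the shapes (A₁), (E₁), (D₁) -/

/-- **The profile data of a past-exact member, normalised for the large-scale chain** (crux hypotheses verbatim, `0 < ρ ≤ ½`):
a profile gradient `G` and ONE constant `c'` such that `V`, `P`, `G` are a.e.-strongly measurable, `G` is a weak derivative of `V`,
and for every `L ≥ 1`: (A₁) `∫_{B_L}|V|² ≤ c' L^{1−2ρ}`, (E₁) `∫_{B_L}|G|²_F ≤ L^{1−ρ}·((1−ρ)/(2+ρ))c'`,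
(D₁) `∫_{B_L}|P|^{3/2} ≤ L^{2−2ρ}·((2−2ρ)/(2+ρ))c'`, together with the weak pressure Poisson equation and the profile local
energy equality (`Past.profileData_of_past`; thresholds `L ≥ 2 − T₁ ↦ L ≥ 1` by `growth_ge_one_of_growth_ge`;
`c' = C_A + C_E (2+ρ)/(1−ρ) + C_D (2+ρ)/(2−2ρ)` after the threshold inflation). [folklore] -/
theorem exists_locData_of_past {ρ : ℝ} (hρ : 0 < ρ) (hρh : ρ ≤ 1 / 2)
    {T T₁ : ℝ} (hT₁ : T₁ ≤ 0) (hTT₁ : T₁ ≤ T) (x₀ : EuclideanSpace ℝ (Fin 3))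
    {u : ℝ → EuclideanSpace ℝ (Fin 3) → EuclideanSpace ℝ (Fin 3)} {p : ℝ → EuclideanSpace ℝ (Fin 3) → ℝ}
    {H : ℝ → EuclideanSpace ℝ (Fin 3) → EuclideanSpace ℝ (Fin 3) →L[ℝ] EuclideanSpace ℝ (Fin 3)} {c : ℝ≥0}
    (hsw : IsSuitableWeakSolutionOn (slab (EuclideanSpace ℝ (Fin 3)) (Iio 0) isOpen_Iio) 0 0 u p)
    (hH : HasWeakSpatialGradientOn (slab (EuclideanSpace ℝ (Fin 3)) (Iio 0) isOpen_Iio) u H)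
    (hgauge : ∀ a : ℝ, 0 < a →
      ENNReal.ofReal (a ^ (2 * ρ)) * cknA a (0 : ℝ × EuclideanSpace ℝ (Fin 3)) u +
          ENNReal.ofReal (a ^ ρ) * cknE a (0 : ℝ × EuclideanSpace ℝ (Fin 3)) H +
        ENNReal.ofReal (a ^ (2 * ρ)) * cknD a (0 : ℝ × EuclideanSpace ℝ (Fin 3)) p ≤ (c : ℝ≥0∞))
    {V : EuclideanSpace ℝ (Fin 3) → EuclideanSpace ℝ (Fin 3)} {P : EuclideanSpace ℝ (Fin 3) → ℝ}
    (hu : ∀ τ : ℝ, τ < T₁ → u τ = fun x => selfSimilarCollapse (1 / (2 + ρ)) T V τ (x - x₀))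
    (hp : ∀ τ : ℝ, τ < T₁ → p τ = fun x => selfSimilarCollapsePressure (1 / (2 + ρ)) T P τ (x - x₀)) :
    ∃ (G : EuclideanSpace ℝ (Fin 3) → EuclideanSpace ℝ (Fin 3) →L[ℝ] EuclideanSpace ℝ (Fin 3)) (c' : ℝ≥0),
      AEStronglyMeasurable V volume ∧ AEStronglyMeasurable P volume ∧ AEStronglyMeasurable G volume ∧
      HasWeakFDerivOn (⊤ : Opens (EuclideanSpace ℝ (Fin 3))) volume V G ∧
      (∀ L : ℝ, 1 ≤ L → ∫⁻ y in ball (0 : EuclideanSpace ℝ (Fin 3)) L, ‖V y‖ₑ ^ 2 ≤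
        (c' : ℝ≥0∞) * ENNReal.ofReal (L ^ (1 - 2 * ρ))) ∧
      (∀ L : ℝ, 1 ≤ L →
        ∫⁻ y in ball (0 : EuclideanSpace ℝ (Fin 3)) L, ENNReal.ofReal (frobeniusNormSq (G y)) ≤
          ENNReal.ofReal (L ^ (1 - ρ)) * (ENNReal.ofReal ((1 - ρ) / (2 + ρ)) * (c' : ℝ≥0∞))) ∧
      (∀ L : ℝ, 1 ≤ L →
        ∫⁻ y in ball (0 : EuclideanSpace ℝ (Fin 3)) L, ‖P y‖ₑ ^ (3 / 2 : ℝ) ≤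
          ENNReal.ofReal (L ^ (2 - 2 * ρ)) * (ENNReal.ofReal ((2 - 2 * ρ) / (2 + ρ)) * (c' : ℝ≥0∞))) ∧
      (∀ θ : EuclideanSpace ℝ (Fin 3) → ℝ, ContDiff ℝ (⊤ : ℕ∞) θ → HasCompactSupport θ →
        ∫ y, P y * (Δ θ) y = -∫ y, fderiv ℝ (fderiv ℝ θ) y (V y) (V y)) ∧
      (∀ σ : EuclideanSpace ℝ (Fin 3) → ℝ, IsTestFunctionOn (⊤ : Opens (EuclideanSpace ℝ (Fin 3))) σ →
        (2 - 5 * (1 / (2 + ρ))) * ∫ x, σ x * ‖V x‖ ^ 2 =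
          (∫ x, (‖V x‖ ^ 2 + 2 * P x) * ⟪V x, gradient σ x⟫) +
            (1 / (2 + ρ)) * ∫ x, ‖V x‖ ^ 2 * ⟪x, gradient σ x⟫) := by
  have hρ1 : ρ < 1 := by linarith
  have h2ρ : (0 : ℝ) < 2 + ρ := by linarith
  -- the three gauges separately
  have hA : ∀ a : ℝ, 0 < a → ENNReal.ofReal (a ^ (2 * ρ)) *
      cknA a (0 : ℝ × EuclideanSpace ℝ (Fin 3)) u ≤ (c : ℝ≥0∞) :=
    fun a ha => le_trans (le_trans le_self_add le_self_add) (hgauge a ha)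
  have hE : ∀ a : ℝ, 0 < a → ENNReal.ofReal (a ^ ρ) *
      cknE a (0 : ℝ × EuclideanSpace ℝ (Fin 3)) H ≤ (c : ℝ≥0∞) :=
    fun a ha => le_trans (le_trans le_add_self le_self_add) (hgauge a ha)
  have hD : ∀ a : ℝ, 0 < a → ENNReal.ofReal (a ^ (2 * ρ)) *
      cknD a (0 : ℝ × EuclideanSpace ℝ (Fin 3)) p ≤ (c : ℝ≥0∞) :=
    fun a ha => le_trans le_add_self (hgauge a ha)
  -- ### the profile data bundle of the past-exact member
  obtain ⟨G, hVm, hPm, hGm, hVG, -, ⟨CA, hCA, hA'⟩, ⟨CE, hCE, hE'⟩, ⟨CD, hCD, hD'⟩, -, -, -, -, -, hPoisson, hEE⟩ :=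
    profileData_of_past hρ hρh hT₁ hTT₁ x₀ hsw.distributional hH hA hE hD hu hp
  -- ### thresholds to `L ≥ 1`
  have hL₀ : (1 : ℝ) ≤ 2 - T₁ := by linarith
  have hA1 := growth_ge_one_of_growth_ge hL₀ (by linarith : (0 : ℝ) ≤ 1 - 2 * ρ) hA'
  have hE1 := growth_ge_one_of_growth_ge hL₀ (by linarith : (0 : ℝ) ≤ 1 - ρ) hE'
  have hD1 := growth_ge_one_of_growth_ge hL₀ (by linarith : (0 : ℝ) ≤ 2 - 2 * ρ) hD'
  -- ### one common constant in the shapes (A₁), (E₁), (D₁)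
  set CA' : ℝ≥0∞ := CA * ENNReal.ofReal ((2 - T₁) ^ (1 - 2 * ρ)) with hCA'
  set CE' : ℝ≥0∞ := CE * ENNReal.ofReal ((2 - T₁) ^ (1 - ρ)) with hCE'
  set CD' : ℝ≥0∞ := CD * ENNReal.ofReal ((2 - T₁) ^ (2 - 2 * ρ)) with hCD'
  have hCA't : CA' ≠ ⊤ := ENNReal.mul_ne_top hCA ENNReal.ofReal_ne_top
  have hCE't : CE' ≠ ⊤ := ENNReal.mul_ne_top hCE ENNReal.ofReal_ne_top
  have hCD't : CD' ≠ ⊤ := ENNReal.mul_ne_top hCD ENNReal.ofReal_ne_top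
  set κE : ℝ := (1 - ρ) / (2 + ρ) with hκE
  set κD : ℝ := (2 - 2 * ρ) / (2 + ρ) with hκD
  have hκE0 : 0 < κE := by rw [hκE]; exact div_pos (by linarith) h2ρ
  have hκD0 : 0 < κD := by rw [hκD]; exact div_pos (by linarith) h2ρ
  set a : ℝ := CA'.toReal with ha
  set e : ℝ := CE'.toReal with he
  set d : ℝ := CD'.toReal with hd
  have ha0 : 0 ≤ a := ENNReal.toReal_nonneg
  have he0 : 0 ≤ e := ENNReal.toReal_nonneg
  have hd0 : 0 ≤ d := ENNReal.toReal_nonneg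
  set c₀ : ℝ := a + e / κE + d / κD with hc₀
  have hc₀0 : 0 ≤ c₀ := by positivity
  set c' : ℝ≥0 := c₀.toNNReal with hc'
  have hcc : (c' : ℝ≥0∞) = ENNReal.ofReal c₀ := rfl
  have haC : CA' = ENNReal.ofReal a := (ENNReal.ofReal_toReal hCA't).symm
  have heC : CE' = ENNReal.ofReal e := (ENNReal.ofReal_toReal hCE't).symm
  have hdC : CD' = ENNReal.ofReal d := (ENNReal.ofReal_toReal hCD't).symm
  have hAle : CA' ≤ (c' : ℝ≥0∞) := by
    rw [haC, hcc]
    refine ENNReal.ofReal_le_ofReal ?_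
    have : 0 ≤ e / κE + d / κD := by positivity
    rw [hc₀]; linarith
  have hEle : CE' ≤ ENNReal.ofReal κE * (c' : ℝ≥0∞) := by
    rw [heC, hcc, ← ENNReal.ofReal_mul hκE0.le]
    refine ENNReal.ofReal_le_ofReal ?_
    have h1 : κE * (e / κE) = e := mul_div_cancel₀ e hκE0.ne'
    have h2 : 0 ≤ κE * a + κE * (d / κD) := by positivity
    rw [hc₀]; nlinarith [h1, h2]
  have hDle : CD' ≤ ENNReal.ofReal κD * (c' : ℝ≥0∞) := by
    rw [hdC, hcc, ← ENNReal.ofReal_mul hκD0.le]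
    refine ENNReal.ofReal_le_ofReal ?_
    have h1 : κD * (d / κD) = d := mul_div_cancel₀ d hκD0.ne'
    have h2 : 0 ≤ κD * a + κD * (e / κE) := by positivity
    rw [hc₀]; nlinarith [h1, h2]
  refine ⟨G, c', hVm, hPm, hGm, hVG, fun L hL => (hA1 L hL).trans (mul_le_mul' hAle le_rfl),
    fun L hL => (hE1 L hL).trans ?_, fun L hL => (hD1 L hL).trans ?_, hPoisson, hEE⟩
  · rw [mul_comm]; exact mul_le_mul' le_rfl hEle
  · rw [mul_comm]; exact mul_le_mul' le_rfl hDle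

/-! ### The two-sided energy law and the sub-extremal dichotomy for past-exact members -/

/-- **The normalised profile energy of a past-exact member converges** (crux hypotheses verbatim, `0 < ρ ≤ ½`, exact
self-similarity about `(T, x₀)` for `τ < T₁`): for every cut-off `σ` with `0 ≤ σ ≤ 1`, `σ = 1` on `B̄₁`, `σ = 0` off `B₂`,
`L^{2ρ−1}∫σ(L⁻¹y)|V|²` has a limit as `L → ∞` (Bronzi–Shvydkoy's two-sided energy law in Seregin's weak class, large-scale data:
`EnergySaturation.tendsto_normEnergy_loc`). [folklore; cf. BronziShvydkoy2015 Thm 1.1] -/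
theorem selfSimilar_tendsto_normEnergy_past {ρ : ℝ} (hρ : 0 < ρ) (hρh : ρ ≤ 1 / 2)
    {T T₁ : ℝ} (hT₁ : T₁ ≤ 0) (hTT₁ : T₁ ≤ T) (x₀ : EuclideanSpace ℝ (Fin 3))
    {u : ℝ → EuclideanSpace ℝ (Fin 3) → EuclideanSpace ℝ (Fin 3)} {p : ℝ → EuclideanSpace ℝ (Fin 3) → ℝ}
    {H : ℝ → EuclideanSpace ℝ (Fin 3) → EuclideanSpace ℝ (Fin 3) →L[ℝ] EuclideanSpace ℝ (Fin 3)} {c : ℝ≥0}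
    (hsw : IsSuitableWeakSolutionOn (slab (EuclideanSpace ℝ (Fin 3)) (Iio 0) isOpen_Iio) 0 0 u p)
    (hH : HasWeakSpatialGradientOn (slab (EuclideanSpace ℝ (Fin 3)) (Iio 0) isOpen_Iio) u H)
    (hgauge : ∀ a : ℝ, 0 < a →
      ENNReal.ofReal (a ^ (2 * ρ)) * cknA a (0 : ℝ × EuclideanSpace ℝ (Fin 3)) u +
          ENNReal.ofReal (a ^ ρ) * cknE a (0 : ℝ × EuclideanSpace ℝ (Fin 3)) H +
        ENNReal.ofReal (a ^ (2 * ρ)) * cknD a (0 : ℝ × EuclideanSpace ℝ (Fin 3)) p ≤ (c : ℝ≥0∞))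
    {V : EuclideanSpace ℝ (Fin 3) → EuclideanSpace ℝ (Fin 3)} {P : EuclideanSpace ℝ (Fin 3) → ℝ}
    (hu : ∀ τ : ℝ, τ < T₁ → u τ = fun x => selfSimilarCollapse (1 / (2 + ρ)) T V τ (x - x₀))
    (hp : ∀ τ : ℝ, τ < T₁ → p τ = fun x => selfSimilarCollapsePressure (1 / (2 + ρ)) T P τ (x - x₀)) 
    {σ : EuclideanSpace ℝ (Fin 3) → ℝ} (hσ : IsTestFunctionOn (⊤ : Opens (EuclideanSpace ℝ (Fin 3))) σ)
    (h0 : ∀ z, 0 ≤ σ z) (h1 : ∀ z, σ z ≤ 1) (hone : ∀ z, ‖z‖ ≤ 1 → σ z = 1)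
    (hzero : ∀ z, 2 ≤ ‖z‖ → σ z = 0) :
    ∃ Ninf : ℝ, Tendsto (fun L : ℝ => L ^ (2 * ρ - 1) * ∫ y, σ (L⁻¹ • y) * ‖V y‖ ^ 2) atTop (𝓝 Ninf) := by
  have hρ1 : ρ < 1 := by linarith
  obtain ⟨G, c', hVm, hPm, hGm, hVG, hA₁, hE₁, hD₁, hPoisson, hEE⟩ :=
    exists_locData_of_past hρ hρh hT₁ hTT₁ x₀ hsw hH hgauge hu hp
  exact EnergySaturation.tendsto_normEnergy_loc hρ hρ1 hσ h0 h1 hone hzero hVm hPm hGm hVG hA₁ hE₁ hD₁ hPoisson hEE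

/-- **NO SUB-EXTREMAL SELF-SIMILAR EULER COLLAPSE ABOUT ANY SPACE–TIME POINT, EVEN ONLY ON A PAST SUB-SLAB** (crux hypotheses
verbatim, `0 < ρ ≤ ½`, `γ = 1/(2+ρ)`).  Let the member `(u, p, H, c)` be exactly self-similar about `(T, x₀)` with profile
`(V, P)` for `τ < T₁` (`T₁ ≤ 0`, `T₁ ≤ T`; arbitrary on `[T₁, 0)`).  If the profile's normalised ball energy is not bounded below —
`∀ ε > 0, ∀ L₀, ∃ L ≥ L₀, L^{2ρ−1}∫_{B_L}|V|² < ε` — then `u = 0` a.e. on `(−∞,0) × ℝ³`.  Proof: `Past.exists_locData_of_past`, the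
large-scale Bronzi–Shvydkoy dichotomy `EnergySaturation.ae_eq_zero_of_subExtremal_loc` (`V = 0` a.e.), and
`Past.ae_eq_zero_of_profile_ae_eq_zero`.  Equivalently a nontrivial such member SATURATES the `A`-gauge:
`∫_{B_L}|V|² ≥ c₁ L^{1−2ρ}` for all large `L`. [folklore; cf. BronziShvydkoy2015 Thm 1.1] -/
theorem selfSimilar_ae_eq_zero_of_subExtremal_past {ρ : ℝ} (hρ : 0 < ρ) (hρh : ρ ≤ 1 / 2)
    {T T₁ : ℝ} (hT₁ : T₁ ≤ 0) (hTT₁ : T₁ ≤ T) (x₀ : EuclideanSpace ℝ (Fin 3))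
    {u : ℝ → EuclideanSpace ℝ (Fin 3) → EuclideanSpace ℝ (Fin 3)} {p : ℝ → EuclideanSpace ℝ (Fin 3) → ℝ}
    {H : ℝ → EuclideanSpace ℝ (Fin 3) → EuclideanSpace ℝ (Fin 3) →L[ℝ] EuclideanSpace ℝ (Fin 3)} {c : ℝ≥0}
    (hsw : IsSuitableWeakSolutionOn (slab (EuclideanSpace ℝ (Fin 3)) (Iio 0) isOpen_Iio) 0 0 u p)
    (hH : HasWeakSpatialGradientOn (slab (EuclideanSpace ℝ (Fin 3)) (Iio 0) isOpen_Iio) u H)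
    (hgauge : ∀ a : ℝ, 0 < a →
      ENNReal.ofReal (a ^ (2 * ρ)) * cknA a (0 : ℝ × EuclideanSpace ℝ (Fin 3)) u +
          ENNReal.ofReal (a ^ ρ) * cknE a (0 : ℝ × EuclideanSpace ℝ (Fin 3)) H +
        ENNReal.ofReal (a ^ (2 * ρ)) * cknD a (0 : ℝ × EuclideanSpace ℝ (Fin 3)) p ≤ (c : ℝ≥0∞))
    {V : EuclideanSpace ℝ (Fin 3) → EuclideanSpace ℝ (Fin 3)} {P : EuclideanSpace ℝ (Fin 3) → ℝ}
    (hu : ∀ τ : ℝ, τ < T₁ → u τ = fun x => selfSimilarCollapse (1 / (2 + ρ)) T V τ (x - x₀))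
    (hp : ∀ τ : ℝ, τ < T₁ → p τ = fun x => selfSimilarCollapsePressure (1 / (2 + ρ)) T P τ (x - x₀))
    (hsub : ∀ ε : ℝ, 0 < ε → ∀ L₀ : ℝ, ∃ L : ℝ, L₀ ≤ L ∧
      L ^ (2 * ρ - 1) * ∫ y in ball (0 : EuclideanSpace ℝ (Fin 3)) L, ‖V y‖ ^ 2 < ε) :
    uncurry u =ᵐ[volume.restrict (Iio (0 : ℝ) ×ˢ (univ : Set (EuclideanSpace ℝ (Fin 3))))] 0 := by
  have hρ1 : ρ < 1 := by linarith
  obtain ⟨G, c', hVm, hPm, hGm, hVG, hA₁, hE₁, hD₁, hPoisson, hEE⟩ :=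
    exists_locData_of_past hρ hρh hT₁ hTT₁ x₀ hsw hH hgauge hu hp
  have hV0 : V =ᵐ[volume] 0 :=
    EnergySaturation.ae_eq_zero_of_subExtremal_loc hρ hρ1 hVm hPm hGm hVG hA₁ hE₁ hD₁ hPoisson hEE hsub
  exact ae_eq_zero_of_profile_ae_eq_zero hρ.le hTT₁ hsw hH hgauge hu hV0

/-- **Corollary: no finite-energy self-similar collapse about any point / on a past sub-slab in the deflation range** (crux
hypotheses verbatim, `0 < ρ < ½`): if the velocity profile has finite energy `∫|V|² < ∞`, the member is trivial
(`L^{2ρ−1}∫_{B_L}|V|² ≤ L^{2ρ−1}∫|V|² → 0`). [folklore] -/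
theorem selfSimilar_ae_eq_zero_of_finiteEnergy_profile_past {ρ : ℝ} (hρ : 0 < ρ) (hρh : ρ < 1 / 2)
    {T T₁ : ℝ} (hT₁ : T₁ ≤ 0) (hTT₁ : T₁ ≤ T) (x₀ : EuclideanSpace ℝ (Fin 3))
    {u : ℝ → EuclideanSpace ℝ (Fin 3) → EuclideanSpace ℝ (Fin 3)} {p : ℝ → EuclideanSpace ℝ (Fin 3) → ℝ}
    {H : ℝ → EuclideanSpace ℝ (Fin 3) → EuclideanSpace ℝ (Fin 3) →L[ℝ] EuclideanSpace ℝ (Fin 3)} {c : ℝ≥0}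
    (hsw : IsSuitableWeakSolutionOn (slab (EuclideanSpace ℝ (Fin 3)) (Iio 0) isOpen_Iio) 0 0 u p)
    (hH : HasWeakSpatialGradientOn (slab (EuclideanSpace ℝ (Fin 3)) (Iio 0) isOpen_Iio) u H)
    (hgauge : ∀ a : ℝ, 0 < a →
      ENNReal.ofReal (a ^ (2 * ρ)) * cknA a (0 : ℝ × EuclideanSpace ℝ (Fin 3)) u +
          ENNReal.ofReal (a ^ ρ) * cknE a (0 : ℝ × EuclideanSpace ℝ (Fin 3)) H +
        ENNReal.ofReal (a ^ (2 * ρ)) * cknD a (0 : ℝ × EuclideanSpace ℝ (Fin 3)) p ≤ (c : ℝ≥0∞))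
    {V : EuclideanSpace ℝ (Fin 3) → EuclideanSpace ℝ (Fin 3)} {P : EuclideanSpace ℝ (Fin 3) → ℝ}
    (hu : ∀ τ : ℝ, τ < T₁ → u τ = fun x => selfSimilarCollapse (1 / (2 + ρ)) T V τ (x - x₀))
    (hp : ∀ τ : ℝ, τ < T₁ → p τ = fun x => selfSimilarCollapsePressure (1 / (2 + ρ)) T P τ (x - x₀))
    (hfin : Integrable (fun y => ‖V y‖ ^ 2) volume) :
    uncurry u =ᵐ[volume.restrict (Iio (0 : ℝ) ×ˢ (univ : Set (EuclideanSpace ℝ (Fin 3))))] 0 := by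
  refine selfSimilar_ae_eq_zero_of_subExtremal_past hρ hρh.le hT₁ hTT₁ x₀ hsw hH hgauge hu hp fun ε hε L₀ => ?_
  -- `L^{2ρ−1} ∫|V|² → 0` (adapted from `EnergySaturation.selfSimilar_ae_eq_zero_of_finiteEnergy_profile'`)
  set E₂ : ℝ := ∫ y, ‖V y‖ ^ 2 with hE₂
  have hE₂0 : 0 ≤ E₂ := integral_nonneg fun y => sq_nonneg _
  have htend : Tendsto (fun L : ℝ => L ^ (2 * ρ - 1) * (E₂ + 1)) atTop (𝓝 (0 * (E₂ + 1))) := by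
    refine Tendsto.mul_const _ ?_
    have := tendsto_rpow_neg_atTop (y := 1 - 2 * ρ) (by linarith)
    simpa [show -(1 - 2 * ρ) = 2 * ρ - 1 by ring] using this
  rw [zero_mul] at htend
  obtain ⟨L, hLε, hLge⟩ := ((htend.eventually (gt_mem_nhds hε)).and (eventually_ge_atTop (max L₀ 1))).exists
  have hL0 : 0 < L := lt_of_lt_of_le one_pos ((le_max_right _ _).trans hLge)
  refine ⟨L, (le_max_left _ _).trans hLge, lt_of_le_of_lt ?_ hLε⟩
  have hball : ∫ y in ball (0 : EuclideanSpace ℝ (Fin 3)) L, ‖V y‖ ^ 2 ≤ E₂ + 1 :=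
    (setIntegral_le_integral hfin (Eventually.of_forall fun y => sq_nonneg _)).trans (by linarith)
  exact mul_le_mul_of_nonneg_left hball (Real.rpow_nonneg hL0.le _)

end Past

end Summit.NavierStokesRegularity.NavierStokesRegularity.Theorems.PowerGaugeEulerLiouville
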